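import Mathlib
import Summits.NavierStokesRegularity.NavierStokesRegularity.Theorems.SubOnsagerCeilingDefs
import Summits.NavierStokesRegularity.NavierStokesRegularity.Theorems.SubOnsagerCeilingOrthantTailCeilingDyadicRatioTwoTools
import HarnessLib

/-!
# `SubOnsagerCeiling.OrthantTailCeiling` — the RUNG `stub_dyadicRatioTwo` of the line
«shell-barrier»: the ν-uniform shell barrier at scale ratio `2` for the scaled one-mode dyadic
tables (helper file for item stmt-NavierStokesRegularity-25507; `--supports`)

**What is proved.** For every `c > 0`, every viscosity `ν > 0`, every one-shell datum `X₀` and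
every honest `ν`-viscous solution `X` on `[0, s]` of Tao's NS-scaled lattice at `ε₀ = 1` with the
table `α = c · dyadicTable` (the Katz–Pavlović chain on component `0`: feed `(1+ε₀)^{5(k-1)/2}X²_{0,k-1}`,
drain `(1+ε₀)^{5k/2}X_{0,k}X_{0,k+1}`, dissipation `ν(1+ε₀)^{2k}`), one has for all `t ∈ [0, s]`,
all components `i` and all shells `k ≥ 0` the weighted per-shell bound

  `2^{2θk} · ½ X_{i,k}(t)² ≤ 100 · Σ_j ½ (X₀ j)²`,   `θ = 51/100 > 1/2`

(`dyadicRatioTwo_shellBarrier`), and hence the registered stub statement in its binder shape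
(`subOnsagerCeiling_stub_dyadicRatioTwo`: the body of `Sig.stub_dyadicRatioTwo` /
`ShellBarrierAt R 1 α` of the skeleton, with `θ = 51/100`, `D = 100`, uniformly in `ν`, `c`, `R`).

**Proof = transport of Barbato–Morandin–Romito 2011** (Thm. 1, first claim of its proof, MACHINE-
CHECKED in the tree as `Literature.Barriers.NavierStokesRegularity.Dyadic.IsBMRWeakSolution.scale_bound`:
for a weak solution of BMR (1.1) at `β = 5/2`, `λ = 2` from a non-negative `ℓ²` datum,
`sup_{t ≥ 0} sup_n λₙ^{0.51} Xₙ(t) ≤ 10 · sup_n λₙ^{0.51} Xₙ(0)`, for EVERY viscosity). The map: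
`U_n(t) = (c/2^{5/2}) · σ · X_{0,n-1}(t)` (`σ = ±1` the sign of the datum on shell `0`, applied to
shell `0` only — the chain is invariant under `X_{0,0} ↦ -X_{0,0}`) solves BMR (1.1) with
viscosity `ν/4` within `[0, s]` (`hasDerivWithinAt_bmr_of_dyadic`); it is non-negative there by
Cheskidov positivity on a finite horizon (`nonneg_of_modes_Icc`); it is glued at time `s` to a
global weak solution from the (non-negative, square-summable) datum `U(s)`
(`exists_isBMRWeakSolution`) to produce a weak solution on `[0, ∞)` (`IsBMRWeakSolution` needs the
whole half-line), to which `scale_bound` applies with `K = 2^{0.51}(c/2^{5/2})|X₀ 0| + η`, `η ↓ 0`.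
The other components carry no nonlinearity (`quadTerm` vanishes off component `0`) and decay.

HONEST FRAMING: a statement about MODEL lattice ODEs (route SubOnsagerCeiling, rung TL-M2Break,
the `ε₀ = 1` one-mode instance); it is the `b = 2` dyadic corner of the crux only; nothing here
bears on Navier–Stokes regularity and no summit is proved.
-/

noncomputable section

-- the sub-problem namespace `NavierStokesRegularity.NavierStokesRegularity` is the tree's layout (D-0017)
set_option linter.dupNamespace false

namespace Summit.NavierStokesRegularity.NavierStokesRegularity.Theorems

open Set Filter
open scoped Topology
open Literature.Analysis.FluidPDE.TaoCascade
open Literature.Barriers.NavierStokesRegularity.Dyadic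

/-! ## The rung: the ν-uniform shell barrier at ratio `2` for scaled dyadic tables -/

/-- **The shell barrier at scale ratio `2` for the scaled one-mode dyadic tables** (`θ = 51/100`,
`D = 100`, uniformly in `ν > 0`, in the scale `c > 0` and in the datum): along every honest
`ν`-viscous solution on `[0, s]` of the `ε₀ = 1` lattice with table `c · dyadicTable` from a one-shell
datum `X₀`, `2^{2θk}·½X_{i,k}(t)² ≤ 100·Σ_j ½(X₀ j)²` for all `t ∈ [0, s]`, `i`, `k ≥ 0`.
Transport of Barbato–Morandin–Romito 2011 (proof of Thm. 1, first claim; tree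
`IsBMRWeakSolution.scale_bound`) through `dyadicRatioTwo_hasDerivWithinAt_bmr` and
`dyadicRatioTwo_glue`; see the module docstring.
[cite: BarbatoMorandinRomito2011, §3.2 (proof of Thm. 1, first claim) and §2 Lemma 2.1] -/
theorem dyadicRatioTwo_shellBarrier {c : ℝ} (hc : 0 < c)
    {α : Fin 4 → Fin 4 → Fin 4 → ℤ × ℤ × ℤ → ℝ}
    (hα : ∀ (i₁ i₂ i₃ : Fin 4) (μ : ℤ × ℤ × ℤ), α i₁ i₂ i₃ μ = c * dyadicTable i₁ i₂ i₃ μ) :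
    ∀ ν : ℝ, 0 < ν → ∀ (X₀ : Fin 4 → ℝ) (s : ℝ), 0 < s → ∀ X : Fin 4 → ℤ → ℝ → ℝ,
      (∀ (i : Fin 4) (k : ℤ), X i k 0 = if k = 0 then X₀ i else 0) →
      (∀ (i : Fin 4) (k : ℤ), k < 0 → ∀ t : ℝ, X i k t = 0) →
      (∃ M : ℝ, ∀ (t : ℝ) (i : Fin 4) (k : ℤ), (1 + (1 + 1) ^ ((10 : ℝ) * k)) * |X i k t| ≤ M) →
      (∀ (i : Fin 4) (k : ℤ), Continuous (X i k)) →
      (∀ (i : Fin 4) (k : ℤ), ∀ t ∈ Set.Icc (0 : ℝ) s, HasDerivWithinAt (X i k)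
        (quadTerm 1 α X i k t - ν * (1 + 1) ^ ((2 : ℝ) * k) * X i k t) (Set.Icc (0 : ℝ) s) t) →
      (∀ t ∈ Set.Icc (0 : ℝ) s, ∀ (i : Fin 4) (k : ℤ), 1 ≤ k → 0 ≤ X i k t) →
      ∀ t ∈ Set.Icc (0 : ℝ) s, ∀ (i : Fin 4) (k : ℕ),
        (1 + 1) ^ (2 * (51 / 100) * (k : ℝ)) * ((1 / 2 : ℝ) * X i (k : ℤ) t ^ 2) ≤
          100 * (∑ j : Fin 4, (1 / 2 : ℝ) * X₀ j ^ 2) := by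
  intro ν hν X₀ s hs X hdat hvan hbdd hcont hode _hnn t ht i k
  have h2 : (1 + 1 : ℝ) = 2 := by norm_num
  set E₀ : ℝ := ∑ j : Fin 4, (1 / 2 : ℝ) * X₀ j ^ 2 with hE₀
  have hE₀i : ∀ j : Fin 4, (1 / 2 : ℝ) * X₀ j ^ 2 ≤ E₀ := fun j =>
    Finset.single_le_sum (f := fun j => (1 / 2 : ℝ) * X₀ j ^ 2) (fun j _ => by positivity)
      (Finset.mem_univ j)
  have hE₀0 : 0 ≤ E₀ := Finset.sum_nonneg fun j _ => by positivity
  by_cases hi : i = 0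
  swap
  · -- components `i ≠ 0`: pure decay `Ẋ = -ν4^kX`, so `X²` does not increase
    have hd : ∀ τ ∈ Icc 0 s, HasDerivWithinAt (fun r => X i k r ^ 2)
        (2 * X i k τ * (0 - ν * (1 + 1) ^ ((2 : ℝ) * (k : ℤ)) * X i k τ)) (Icc 0 s) τ := by
      intro τ hτ
      have h := hode i k τ hτ
      rw [dyadicRatioTwo_quadTerm_of_ne hα X hi] at h
      exact hasDerivWithinAt_sq h
    have hle := le_add_mul_of_deriv_le_Icc hd (C := 0) (fun τ _ => by
      have hw : 0 ≤ ν * (1 + 1 : ℝ) ^ ((2 : ℝ) * (k : ℤ)) :=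
        mul_nonneg hν.le (Real.rpow_nonneg (by norm_num) _)
      nlinarith [sq_nonneg (X i k τ)]) t ht
    rw [zero_mul, add_zero, hdat i k] at hle
    have hw0 : 0 ≤ (1 + 1 : ℝ) ^ (2 * (51 / 100) * (k : ℝ)) := Real.rpow_nonneg (by norm_num) _
    rcases Nat.eq_zero_or_pos k with rfl | hk
    · simp only [Nat.cast_zero, mul_zero, Real.rpow_zero, one_mul, if_true] at hle ⊢
      calc (1 / 2 : ℝ) * X i 0 t ^ 2 ≤ (1 / 2 : ℝ) * X₀ i ^ 2 := by linarith
        _ ≤ E₀ := hE₀i i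
        _ ≤ 100 * E₀ := by linarith
    · rw [if_neg (by exact_mod_cast hk.ne')] at hle
      have hX0 : X i k t ^ 2 = 0 := le_antisymm (by simpa using hle) (sq_nonneg _)
      rw [hX0, mul_zero, mul_zero]
      exact mul_nonneg (by norm_num) hE₀0
  -- component `0`: the Katz–Pavlović chain, transported to BMR (1.1)
  subst hi
  have hβ : (5 / 2 : ℝ) ≠ 0 := by norm_num
  set q : ℝ := (2 : ℝ) ^ ((5 : ℝ) / 2) with hq
  have hq0 : 0 < q := Real.rpow_pos_of_pos (by norm_num) _
  set A : ℝ := c / q with hA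
  have hA0 : 0 < A := div_pos hc hq0
  set σ : ℝ := if 0 ≤ X₀ 0 then 1 else -1 with hσ
  have hσ2 : σ ^ 2 = 1 := by rw [hσ]; split_ifs <;> norm_num
  have hσa : σ * X₀ 0 = |X₀ 0| := by
    rw [hσ]; split_ifs with h
    · rw [abs_of_nonneg h, one_mul]
    · rw [abs_of_neg (not_le.1 h)]; ring
  set U : ℕ → ℝ → ℝ := fun n τ =>
    if n = 0 then 0 else if n = 1 then A * (σ * X 0 0 τ) else A * X 0 ((n - 1 : ℕ) : ℤ) τ with hU
  have hU0 : ∀ τ, U 0 τ = 0 := fun τ => by simp [hU]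
  have hU1 : ∀ τ, U 1 τ = c / (2 : ℝ) ^ ((5 : ℝ) / 2) * (σ * X 0 0 τ) := fun τ => by simp [hU, hA, hq]
  have hU2 : ∀ m : ℕ, 1 ≤ m → ∀ τ, U (m + 1) τ = c / (2 : ℝ) ^ ((5 : ℝ) / 2) * X 0 (m : ℤ) τ := by
    intro m hm τ
    have hm' : m ≠ 0 := by omega
    simp [hU, hA, hq, hm']
  have hUsq : ∀ m : ℕ, ∀ τ, U (m + 1) τ ^ 2 = A ^ 2 * X 0 (m : ℤ) τ ^ 2 := by
    intro m τ
    rcases Nat.eq_zero_or_pos m with rfl | hm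
    · rw [show (0 : ℕ) + 1 = 1 from rfl, hU1, ← hq, ← hA]
      push_cast
      calc (A * (σ * X 0 0 τ)) ^ 2 = A ^ 2 * σ ^ 2 * X 0 0 τ ^ 2 := by ring
        _ = A ^ 2 * X 0 0 τ ^ 2 := by rw [hσ2, mul_one]
    · rw [hU2 m hm, ← hq, ← hA]; ring
  -- the chain's equation of motion on component `0`, normalised
  have hode' : ∀ (m : ℕ), ∀ τ ∈ Icc 0 s, HasDerivWithinAt (X 0 m)
      (c * ((2 : ℝ) ^ ((5 : ℝ) * ((m : ℝ) - 1) / 2) * X 0 ((m : ℤ) - 1) τ ^ 2 -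
          (2 : ℝ) ^ ((5 : ℝ) * (m : ℝ) / 2) * (X 0 m τ * X 0 ((m : ℤ) + 1) τ)) -
        ν * (2 : ℝ) ^ ((2 : ℝ) * (m : ℝ)) * X 0 m τ) (Icc 0 s) τ := by
    intro m τ hτ
    have h := hode 0 (m : ℤ) τ hτ
    rw [dyadicRatioTwo_quadTerm_zero hα, h2] at h
    push_cast at h
    exact h
  have hvan' : ∀ τ, X 0 (-1) τ = 0 := fun τ => hvan 0 (-1) (by norm_num) τ
  have hUd := dyadicRatioTwo_hasDerivWithinAt_bmr (ν := ν) hσ2 hvan' hode' hU1 hU2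
  -- positivity on `[0, s]` (Cheskidov, finite horizon)
  have hUcont : ∀ m : ℕ, ContinuousOn (U (m + 2)) (Icc 0 s) := by
    intro m
    have : U (m + 2) = fun τ => c / (2 : ℝ) ^ ((5 : ℝ) / 2) * X 0 ((m + 1 : ℕ) : ℤ) τ :=
      funext fun τ => hU2 (m + 1) (by omega) τ
    rw [this]
    exact (continuous_const.mul (hcont 0 _)).continuousOn
  have hUinit : ∀ m : ℕ, U (m + 1) 0 = if m = 0 then A * |X₀ 0| else 0 := by
    intro m
    rcases Nat.eq_zero_or_pos m with rfl | hm
    · rw [show (0 : ℕ) + 1 = 1 from rfl, hU1, hdat, ← hq, ← hA, if_pos rfl, if_pos rfl, hσa]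
    · rw [hU2 m hm, hdat, if_neg (by exact_mod_cast hm.ne'), if_neg hm.ne', mul_zero]
  have hUinit0 : ∀ m : ℕ, 0 ≤ U (m + 1) 0 := by
    intro m; rw [hUinit]; split_ifs
    · exact mul_nonneg hA0.le (abs_nonneg _)
    · exact le_rfl
  have hUnn : ∀ m : ℕ, ∀ τ ∈ Icc 0 s, 0 ≤ U (m + 1) τ := fun m =>
    nonneg_of_modes_Icc (N := m + 1) hβ (fun j _ τ hτ => hUd j τ hτ) (hUcont m)
      (fun j _ => hUinit0 j) m (Nat.lt_succ_self m)
  -- the datum at time `s`: non-negative and square-summable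
  have hxs : ∀ n, 1 ≤ n → 0 ≤ U n s := by
    intro n hn
    obtain ⟨m, rfl⟩ : ∃ m, n = m + 1 := ⟨n - 1, by omega⟩
    exact hUnn m s ⟨hs.le, le_rfl⟩
  obtain ⟨M, hM⟩ := hbdd
  have hM0 : 0 ≤ M := le_trans (mul_nonneg (by positivity) (abs_nonneg _)) (hM 0 0 0)
  set r : ℝ := 1 / 1024 with hr
  have hr0 : 0 ≤ r := by rw [hr]; norm_num
  have hr1 : r ^ 2 < 1 := by rw [hr]; norm_num
  have hXle : ∀ (m : ℕ) (τ : ℝ), |X 0 m τ| ≤ M * r ^ m := by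
    intro m τ
    have h := hM τ 0 m
    have hw : (1 + 1 : ℝ) ^ ((10 : ℝ) * ((m : ℤ) : ℝ)) = (1024 : ℝ) ^ m := by
      rw [h2, Int.cast_natCast, Real.rpow_mul (by norm_num : (0 : ℝ) ≤ 2), Real.rpow_natCast]
      norm_num
    rw [hw] at h
    have hp : 0 < (1024 : ℝ) ^ m := by positivity
    rw [show M * r ^ m = M / 1024 ^ m by rw [hr, div_pow, one_pow]; ring, le_div_iff₀ hp]
    nlinarith [abs_nonneg (X 0 m τ)]
  have hxs2 : Summable fun n => U n s ^ 2 := by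
    refine (summable_nat_add_iff 1).1 ?_
    have hg : Summable fun m : ℕ => (A * M) ^ 2 * (r ^ 2) ^ m :=
      (summable_geometric_of_lt_one (by positivity) hr1).mul_left _
    refine Summable.of_nonneg_of_le (fun m => sq_nonneg _) (fun m => ?_) hg
    show U (m + 1) s ^ 2 ≤ (A * M) ^ 2 * (r ^ 2) ^ m
    rw [hUsq]
    have h1 : X 0 (m : ℤ) s ^ 2 ≤ (M * r ^ m) ^ 2 := by
      rw [← sq_abs]
      exact pow_le_pow_left₀ (abs_nonneg _) (hXle m s) 2
    calc A ^ 2 * X 0 (m : ℤ) s ^ 2 ≤ A ^ 2 * (M * r ^ m) ^ 2 :=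
          mul_le_mul_of_nonneg_left h1 (by positivity)
      _ = (A * M) ^ 2 * (r ^ 2) ^ m := by ring
  -- glue to a global weak solution from the datum `U(s)`
  obtain ⟨V, hV, -⟩ := exists_isBMRWeakSolution (ν := ν / 4) (β := 5 / 2) (by positivity) hβ hxs hxs2
  have hUall : ∀ n, 1 ≤ n → ∀ τ ∈ Icc 0 s,
      HasDerivWithinAt (U n) (bmrRHS (ν / 4) (5 / 2) (fun m => U m τ) n) (Icc 0 s) τ := by
    intro n hn τ hτ
    obtain ⟨m, rfl⟩ : ∃ m, n = m + 1 := ⟨n - 1, by omega⟩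
    exact hUd m τ hτ
  have hW := dyadicRatioTwo_glue hβ hs.le hUall hV
  -- its datum `U(0)` is non-negative and square-summable
  have hx0 : ∀ n, 1 ≤ n → 0 ≤ U n 0 := by
    intro n hn
    obtain ⟨m, rfl⟩ : ∃ m, n = m + 1 := ⟨n - 1, by omega⟩
    exact hUinit0 m
  have hx02 : Summable fun n => U n 0 ^ 2 := by
    refine summable_of_ne_finset_zero (s := {1}) fun n hn => ?_
    rw [Finset.mem_singleton] at hn
    rcases Nat.eq_zero_or_pos n with rfl | hn0
    · rw [hU0]; ring
    · obtain ⟨m, rfl⟩ : ∃ m, n = m + 1 := ⟨n - 1, by omega⟩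
      rw [hUinit, if_neg (by omega)]; ring
  -- Barbato–Morandin–Romito's a priori bound, for every `η > 0`
  set a : ℝ := 5 / 2 - 2 + 1 / 100 with ha
  have hbound : ∀ η : ℝ, 0 < η →
      bmrLambda (k + 1) ^ a * U (k + 1) t ≤ 10 * (bmrLambda 1 ^ a * U 1 0 + η) := by
    intro η hη
    have hK : 0 < bmrLambda 1 ^ a * U 1 0 + η :=
      add_pos_of_nonneg_of_pos (mul_nonneg (bmrLambda_rpow_nonneg 1 a) (hx0 1 le_rfl)) hη
    have hbd : ∀ n, 1 ≤ n → bmrLambda n ^ a *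
        (fun n τ => if τ ≤ s then U n τ else V n (τ - s)) n 0 ≤ bmrLambda 1 ^ a * U 1 0 + η := by
      intro n hn
      simp only [if_pos hs.le]
      obtain ⟨m, rfl⟩ : ∃ m, n = m + 1 := ⟨n - 1, by omega⟩
      rcases Nat.eq_zero_or_pos m with rfl | hm
      · linarith
      · rw [hUinit, if_neg hm.ne', mul_zero]; exact hK.le
    have h := hW.scale_bound (by positivity) (by norm_num) le_rfl hx0 hx02 le_rfl hK hbd t ht.1
      (k + 1) (by omega)
    simp only [if_pos ht.2] at h
    exact h
  have hmain : bmrLambda (k + 1) ^ a * U (k + 1) t ≤ 10 * (bmrLambda 1 ^ a * U 1 0) :=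
    le_of_forall_pos_le_add fun η hη =>
      calc bmrLambda (k + 1) ^ a * U (k + 1) t ≤ 10 * (bmrLambda 1 ^ a * U 1 0 + η / 10) :=
            hbound (η / 10) (by positivity)
        _ = 10 * (bmrLambda 1 ^ a * U 1 0) + η := by ring
  -- unpack: `2^{0.51(k+1)} U_{k+1}(t) ≤ 10 · 2^{0.51} · A|X₀ 0|`
  have ha' : a = 51 / 100 := by rw [ha]; norm_num
  have hL1 : bmrLambda 1 ^ a = (2 : ℝ) ^ (51 / 100 : ℝ) := by
    rw [bmrLambda_of_ne_zero one_ne_zero, pow_one, ha']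
  have hLk : bmrLambda (k + 1) ^ a = (2 : ℝ) ^ (51 / 100 : ℝ) * (2 : ℝ) ^ ((51 / 100 : ℝ) * k) := by
    rw [bmrLambda_succ, dyadicRatioTwo_two_pow_rpow, ha', ← Real.rpow_add (by norm_num : (0 : ℝ) < 2)]
    push_cast; ring_nf
  have h51 : 0 < (2 : ℝ) ^ (51 / 100 : ℝ) := Real.rpow_pos_of_pos (by norm_num) _
  have hU10 : U 1 0 = A * |X₀ 0| := by simpa using hUinit 0
  rw [hLk, hL1, hU10] at hmain
  have hmain' : (2 : ℝ) ^ ((51 / 100 : ℝ) * k) * U (k + 1) t ≤ 10 * (A * |X₀ 0|) := by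
    have := hmain
    rw [mul_assoc] at this
    have h' : (2 : ℝ) ^ (51 / 100 : ℝ) * ((2 : ℝ) ^ ((51 / 100 : ℝ) * k) * U (k + 1) t) ≤
        (2 : ℝ) ^ (51 / 100 : ℝ) * (10 * (A * |X₀ 0|)) := by linarith
    exact le_of_mul_le_mul_left h' h51
  -- square it
  have hUkt : 0 ≤ U (k + 1) t := hUnn k t ht
  have hw : 0 ≤ (2 : ℝ) ^ ((51 / 100 : ℝ) * k) := (Real.rpow_pos_of_pos (by norm_num) _).le
  have hsq : ((2 : ℝ) ^ ((51 / 100 : ℝ) * k) * U (k + 1) t) ^ 2 ≤ (10 * (A * |X₀ 0|)) ^ 2 :=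
    pow_le_pow_left₀ (mul_nonneg hw hUkt) hmain' 2
  rw [mul_pow, hUsq, mul_pow, mul_pow, sq_abs] at hsq
  have hwsq : (1 + 1 : ℝ) ^ (2 * (51 / 100) * (k : ℝ)) = ((2 : ℝ) ^ ((51 / 100 : ℝ) * k)) ^ 2 := by
    rw [h2, ← Real.rpow_natCast, ← Real.rpow_mul (by norm_num : (0 : ℝ) ≤ 2)]
    push_cast; ring_nf
  rw [hwsq]
  have hA2 : 0 < A ^ 2 := by positivity
  -- `w² · A² X² ≤ 100 A² X₀²` ⇒ `w² · ½X² ≤ 100 · ½X₀² ≤ 100 E₀`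
  have hfin : ((2 : ℝ) ^ ((51 / 100 : ℝ) * k)) ^ 2 * X 0 (k : ℤ) t ^ 2 ≤ 100 * X₀ 0 ^ 2 := by
    have := hsq
    nlinarith
  calc ((2 : ℝ) ^ ((51 / 100 : ℝ) * k)) ^ 2 * ((1 / 2 : ℝ) * X 0 (k : ℤ) t ^ 2)
      = (1 / 2 : ℝ) * (((2 : ℝ) ^ ((51 / 100 : ℝ) * k)) ^ 2 * X 0 (k : ℤ) t ^ 2) := by ring
    _ ≤ (1 / 2 : ℝ) * (100 * X₀ 0 ^ 2) := by linarith
    _ = 100 * ((1 / 2 : ℝ) * X₀ 0 ^ 2) := by ring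
    _ ≤ 100 * E₀ := by linarith [hE₀i 0]

/-- **The registered stub `stub_dyadicRatioTwo` in its binder shape** (the body of
`Sig.stub_dyadicRatioTwo` of the skeleton `Cruxes/OrthantTailCeiling/Lines/shell_barrier.lean`
with `IsScaledDyadic` and `ShellBarrierAt R 1 α` unfolded): for every `R ≥ 1` and every scaled
one-mode dyadic table, the ν-uniform shell barrier at scale ratio `2` holds with `θ = 51/100`,
`D = 100` (the table-class and orthant hypotheses are not needed).
[cite: BarbatoMorandinRomito2011, §3.2 (proof of Thm. 1, first claim)] -/
theorem subOnsagerCeiling_dyadicRatioTwo :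
    ∀ R : ℝ, 1 ≤ R → ∀ α : Fin 4 → Fin 4 → Fin 4 → ℤ × ℤ × ℤ → ℝ,
      (∃ c : ℝ, 0 < c ∧ ∀ (i₁ i₂ i₃ : Fin 4) (μ : ℤ × ℤ × ℤ),
        α i₁ i₂ i₃ μ = c * dyadicTable i₁ i₂ i₃ μ) →
      InTableClass R α → (∀ (Y : Fin 4 → ℤ → ℝ → ℝ) (τ : ℝ), (∀ (j : Fin 4) (k : ℤ), 1 ≤ k → 0 ≤ Y j k τ) → ∀ δ : ℝ, 0 < δ → ∀ (i : Fin 4) (n : ℤ), 1 ≤ n → Y i n τ = 0 → 0 ≤ quadTerm δ α Y i n τ) → ∃ θ : ℝ, 1 / 2 < θ ∧ ∃ D : ℝ, 0 ≤ D ∧ ∀ ν : ℝ, 0 < ν → ∀ (X₀ : Fin 4 → ℝ) (s : ℝ), 0 < s → ∀ X : Fin 4 → ℤ → ℝ → ℝ, (∀ (i : Fin 4) (k : ℤ), X i k 0 = if k = 0 then X₀ i else 0) → (∀ (i : Fin 4) (k : ℤ), k < 0 → ∀ t : ℝ, X i k t = 0) → (∃ M : ℝ, ∀ (t : ℝ)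 (i : Fin 4) (k : ℤ), (1 + (1 + 1) ^ ((10 : ℝ) * k)) * |X i k t| ≤ M) → (∀ (i : Fin 4) (k : ℤ), Continuous (X i k)) → (∀ (i : Fin 4) (k : ℤ), ∀ t ∈ Set.Icc (0 : ℝ) s, HasDerivWithinAt (X i k) (quadTerm 1 α X i k t - ν * (1 + 1) ^ ((2 : ℝ) * k) * X i k t) (Set.Icc (0 : ℝ) s) t) → (∀ t ∈ Set.Icc (0 : ℝ) s, ∀ (i : Fin 4) (k : ℤ), 1 ≤ k → 0 ≤ X i k t) → ∀ t ∈ Set.Icc (0 : ℝ) s, ∀ (i : Fin 4) (k : ℕ), (1 + 1) ^ (2 * θ * (k : ℝ)) * ((1 / 2 : ℝ) * X i (k : ℤ) t ^ 2) ≤ D * (∑ j : Fin 4, (1 / 2 : ℝ) * X₀ j ^ 2) := by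
  intro R _hR α hα _hT _hO
  obtain ⟨c, hc, hα⟩ := hα
  exact ⟨51 / 100, by norm_num, 100, by norm_num, dyadicRatioTwo_shellBarrier hc hα⟩


namespace SubOnsagerCeiling

/-- **The registered stub `stub_dyadicRatioTwo` of the skeleton «shell-barrier»** (crux
`SubOnsagerCeiling.OrthantTailCeiling`, item stmt-NavierStokesRegularity-25507), verbatim:
`∀ R ≥ 1, ∀ α, IsScaledDyadic α → ShellBarrierAt R 1 α` — by `subOnsagerCeiling_dyadicRatioTwo`.
[cite: BarbatoMorandinRomito2011, §3.2 (proof of Thm. 1, first claim)] -/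
theorem stub_dyadicRatioTwo : Sig.stub_dyadicRatioTwo :=
  fun R hR α hα hT hO => subOnsagerCeiling_dyadicRatioTwo R hR α hα hT hO

end SubOnsagerCeiling

end Summit.NavierStokesRegularity.NavierStokesRegularity.Theorems

end
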